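import Summits.HodgeConjecture.HodgeConjecture.Theorems.Ring2WeilCoverageLatticeNormTwist
import Summits.HodgeConjecture.HodgeConjecture.Theorems.Ring2WeilCoverageCyclotomicSignaturesG12C
import Summits.HodgeConjecture.HodgeConjecture.Theorems.Ring2WeilCoverageRealQuadraticUnitNorm
import HarnessLib

/-!
# Weil-type family coverage — level `M = 72`, the NON-PRINCIPAL lattice classes: the prime `𝔓 = (1 − ζ⁸, 1 + ζ⁹ + ζ²⁷)` over `3`
# has `𝔓𝔓^ρ = (1 − ζ⁸) = (α)` with `α = u(20,8,58)·u(3,15,63)` TOTALLY POSITIVE, so `ℂ^Φ/Φ(𝔓)` and `ℂ^Φ/Φ(𝔓^ρ)` repeat the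
# verdict of `ℤ[ζ₇₂]`: every `K`-balanced CM type of the four rows at `72` is principally polarisable on all three classes

research route conditional on HC_CM; not a corollary; Q11.4-sentence-2 already refuted in dim ≥ 3.

Ring 2, WEIL-TYPE FAMILY-COVERAGE CENSUS (`HOME/WEIL-FAMILY-COVERAGE.md` `## b01`, block b01.40 (C) «the `h = 3` levels `52/72`:
all three lattice classes repeat the principal verdict — GIVEN the printed `h⁺ = 1`», owner ring2-b01), part 47 of the
`Ring2WeilCoverage*` series — the level-`72` twin of part 46.  `h(ℚ(ζ₇₂)) = 3` [Washington1997, tables §11]; the two primes over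
`3` are conjugate and represent the two non-trivial classes (PARI `bnfisprincipal`, job j214838; not proved here).  Kernel content:

* §1 the element `α = u(20,8,58)·u(3,15,63)`, `u(a,b,h) = ζ^h(1 − ζ^a)(1 − ζ^b)` (part 13, `2h + a + b = 144`): by part 13's
  `re_embedding_prod_neg_iff` and a `decide`d parity table, **`Re σ(α) > 0` at EVERY embedding** and `α^ρ = α`.  The only
  non-unit factor is `1 − ζ⁸` (`ζ⁸` of order `9`); `1 − ζ²⁰`, `1 − ζ³`, `1 − ζ¹⁵` have orders `18, 24, 24` and are units (part 13).
* §2 the lattice: `𝔓 = (1 − ζ⁸, 1 + ζ⁹ + ζ²⁷)` (`3 = (1 + √−2)(1 − √−2)`, `√−2 = ζ⁹ + ζ²⁷`), `𝔓^ρ = (1 − ζ⁶⁴, 1 + ζ⁶³ + ζ⁴⁵)`,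
  **`𝔓𝔓^ρ = (1 − ζ⁸)`** (`span_mul_span_conj_eq`: the four products are `(1 − ζ⁸)`-multiples — `3 = (1 − ζ⁸)·q₄` included — and
  `1 − ζ⁸ = (1 − ζ⁸)·g₄ − g₂ + ζ⁸·g₃`; `linear_combination`s mod `(1 + ζ³⁶, 1 + ζ²⁴ + ζ⁴⁸, ζ⁷² − 1)`, certificates
  `g60/py52/cert5272.py`), and `(α) = (1 − ζ⁸)` (`span_alpha_eq`, the cofactor is a unit).
* §3 **`principal_iff_of_mul_conjIdeal_eq`**: for ANY lattice `𝔪` with `𝔪𝔪^ρ = (α)` and any CM type `Φ`, `ℂ^Φ/D(𝔪)` carries an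
  `ι`-compatible principal polarisation iff `ℂ^Φ/Φ(ℤ[ζ₇₂])` does (part 42 with `Φ_α = Φ`); specialised to `𝔪 ∈ {𝔓, 𝔓^ρ}`
  (`principal_iff_seventyTwo_nonprincipal`); the four census rows `(72, ℚ(i) / ℚ(√−2) / ℚ(√−3) / ℚ(√−6))` ON `𝔓` AND
  ON `𝔓^ρ`: **YES for every `K`-balanced CM type** (part 24's `exists_principal_seventyTwo_…` transported).

HONEST FRAMING: statements about Shimura's divisors of principal type on the principal CM tori `ℂ^Φ/D(𝔪)` with `𝔪𝔪^ρ = (α)`,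
elementary ideal arithmetic in `ℤ[ζ₇₂]` and sign combinatorics; that `{ℤ[ζ₇₂], 𝔓, 𝔓^ρ}` represent ALL lattice classes is
`h = 3` (printed) + `[𝔓] ≠ 1` (PARI) and is NOT proved here; nothing about Hodge classes, `W_K`, general members or HC; `HC_CM` is
used nowhere.  No `def`, no named fact, no `sorry`.  References: [cite: Shimura1998, §14.3 Prop. 4–5, pp. 103–104; §14.4 Prop. 7,
p. 105]; [cite: Washington1997, §8.1, Prop. 2.8, tables §11]; census b01.36, b01.40 (seat-derived).
-/

noncomputable section

open Polynomial NumberField NumberField.ComplexEmbedding Complex Finset FractionalIdeal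
open scoped nonZeroDivisors Real

namespace Summit.HodgeConjecture.Ring2WeilCoverage.NonPrincipalLatticeLevel72

open Literature.AlgebraicGeometry.Motives (CMType)
open Literature.AlgebraicGeometry.ComplexMultiplication.CyclotomicCMType
open Literature.NumberTheory.ComplexMultiplication
open Literature.NumberTheory.NumberFields
open Summit.HodgeConjecture.Ring2WeilCoverage.LatticeNormTwist
open Summit.HodgeConjecture.Ring2WeilCoverage.CyclotomicUnitProducts
  (re_embedding_gen re_embedding_prod_neg_iff isUnit_one_sub_toInteger_pow)
open Summit.HodgeConjecture.Ring2WeilCoverage.CyclotomicSignaturesG12C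
  (exists_principal_seventyTwo_sqrt_neg_one exists_principal_seventyTwo_sqrt_neg_two exists_principal_seventyTwo_sqrt_neg_three
    exists_principal_seventyTwo_sqrt_neg_six)
open Summit.HodgeConjecture.Ring2WeilCoverage.RealQuadraticUnitNorm (complexConj_eq_inv_of_pow_eq_one)

variable {K : Type} [Field K] [NumberField K] [IsCMField K] {ζ : K}

/-- `𝐞(t) = exp(2πi t/72) ∈ ℂ` (`ZMod.toCircle`). -/
local notation3 (prettyPrint := false) "𝐞 " t:max => ((ZMod.toCircle t : Circle) : ℂ)
/-- part 13's generator `u(x) = ζ^h(1 − ζ^a)(1 − ζ^b)` for `x = (a, b, h)`. -/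
local notation3 (prettyPrint := false) "𝐮 " x:max =>
  (ζ ^ (x : ℕ × ℕ × ℕ).2.2 * (1 - ζ ^ (x : ℕ × ℕ × ℕ).1) * (1 - ζ ^ (x : ℕ × ℕ × ℕ).2.1))
/-- the sign predicate of `u(x)` at the unit residue `t` (part 13). -/
local notation3 (prettyPrint := false) "negAt " x:max t:max =>
  (72 < (x : ℕ × ℕ × ℕ).1 * ZMod.val t % (2 * 72) ↔ 72 < (x : ℕ × ℕ × ℕ).2.1 * ZMod.val t % (2 * 72))
/-- the two triples of `α`. -/
local notation3 (prettyPrint := false) "A72" => ({(20, 8, 58), (3, 15, 63)} : Finset (ℕ × ℕ × ℕ))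
/-- `α = u(20,8,58)·u(3,15,63)` written out. -/
local notation3 (prettyPrint := false) "α" =>
  (ζ ^ 58 * (1 - ζ ^ 20) * (1 - ζ ^ 8) * (ζ ^ 63 * (1 - ζ ^ 3) * (1 - ζ ^ 15)))
/-- the lattice `𝔓 = (1 − ζ⁸, 1 + ζ⁹ + ζ²⁷) ⊂ 𝓞 K` (a prime over `3`). -/
local notation3 (prettyPrint := false) "𝔓[" hζ "]" =>
  (Ideal.span {1 - IsPrimitiveRoot.toInteger hζ ^ 8,
    1 + IsPrimitiveRoot.toInteger hζ ^ 9 + IsPrimitiveRoot.toInteger hζ ^ 27} : Ideal (𝓞 K))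
/-- its conjugate `𝔓^ρ = (1 − ζ⁶⁴, 1 + ζ⁶³ + ζ⁴⁵)`. -/
local notation3 (prettyPrint := false) "𝔓ρ[" hζ "]" =>
  (Ideal.span {1 - IsPrimitiveRoot.toInteger hζ ^ 64,
    1 + IsPrimitiveRoot.toInteger hζ ^ 63 + IsPrimitiveRoot.toInteger hζ ^ 45} : Ideal (𝓞 K))

/-! ### §1 The totally positive element `α` -/

omit [NumberField K] [IsCMField K] in
/-- `∏_{x ∈ A} u(x) = α` (the written-out product). [folklore] -/
theorem prod_A72_eq : (∏ x ∈ A72, 𝐮 x) = α := by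
  rw [Finset.prod_insert (by decide), Finset.prod_singleton]

/-- The `decide`d data: the two triples satisfy part 13's side conditions (`72 ∤ a, b`, `2h + a + b ≡ 0 (mod 144)`), and at
every unit residue `t` an EVEN number of the two factors is negative. [folklore] -/
theorem A72_facts :
    (∀ x ∈ A72, ¬ 72 ∣ x.1 ∧ ¬ 72 ∣ x.2.1 ∧ (2 * x.2.2 + x.1 + x.2.1) % (2 * 72) = 0) ∧
    (∀ t : ZMod 72, t.val.Coprime 72 → Even ((Finset.filter (fun x => negAt x t) A72).card)) := by
  refine ⟨by decide, by decide⟩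

omit [NumberField K] [IsCMField K] in
/-- **`Re σ(α) > 0` and `Im σ(α) = 0`** whenever `σ ζ = 𝐞(t)`, `t` a unit residue (part 13's signed-product read + the table).
research route conditional on HC_CM; not a corollary; Q11.4-sentence-2 already refuted in dim ≥ 3. [cite: Washington1997, §8.1] -/
theorem alpha_read {σ : K →+* ℂ} {t : ZMod 72} (ht : t.val.Coprime 72) (hσ : σ ζ = 𝐞 t) :
    0 < (σ α).re ∧ (σ α).im = 0 := by
  obtain ⟨hA, hev⟩ := A72_facts
  obtain ⟨hneg, hne⟩ := re_embedding_prod_neg_iff (n := 72) hσ ht A72 hA false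
  simp only [Bool.false_eq_true, ↓reduceIte, one_mul, add_zero] at hneg hne
  rw [prod_A72_eq] at hneg hne
  have him : ∀ x ∈ A72, (σ (𝐮 x)).im = 0 := fun x hx =>
    (re_embedding_gen hσ ht (hA x hx).1 (hA x hx).2.1 (hA x hx).2.2).2.2
  have hreal : ∀ x ∈ A72, σ (𝐮 x) = (((σ (𝐮 x)).re : ℝ) : ℂ) := fun x hx =>
    Complex.ext (by simp) (by rw [Complex.ofReal_im]; exact him x hx)
  have hprod : σ α = ((∏ x ∈ A72, (σ (𝐮 x)).re : ℝ) : ℂ) := by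
    rw [← prod_A72_eq, map_prod, Complex.ofReal_prod]
    exact Finset.prod_congr rfl hreal
  exact ⟨lt_of_le_of_ne (not_lt.mp fun h => (Nat.not_odd_iff_even.mpr (hev t ht)) (hneg.mp h)) hne.symm,
    by rw [hprod, Complex.ofReal_im]⟩

/-- **`α ∈ ℚ(ζ₇₂)⁺` and `α` is TOTALLY POSITIVE**: `α^ρ = α` and `Re φ(α) > 0` for every embedding `φ`.
research route conditional on HC_CM; not a corollary; Q11.4-sentence-2 already refuted in dim ≥ 3. [folklore] -/
theorem alpha_real_pos (hζ : IsPrimitiveRoot ζ 72) :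
    IsCMField.complexConj K α = α ∧ ∀ φ : K →+* ℂ, 0 < (φ α).re := by
  refine ⟨?_, fun φ => ?_⟩
  · obtain ⟨φ⟩ := (inferInstance : Nonempty (K →+* ℂ))
    obtain ⟨t, ht, hφ⟩ := exists_apply_eq_toCircle hζ φ
    obtain ⟨-, him⟩ := alpha_read ht hφ
    apply φ.injective
    rw [IsCMField.complexEmbedding_complexConj]
    exact Complex.ext (by rw [Complex.conj_re]) (by rw [Complex.conj_im, him, neg_zero])
  · obtain ⟨t, ht, hφ⟩ := exists_apply_eq_toCircle hζ φ
    exact (alpha_read ht hφ).1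

/-! ### §2 The lattice `𝔓 = (1 − ζ⁸, 1 + ζ⁹ + ζ²⁷)`: `𝔓𝔓^ρ = (1 − ζ⁸) = (α)` -/

section Lattice

omit [NumberField K] [IsCMField K] in
/-- The cyclotomic relations at `72`: `1 + ζ³⁶ = 0`, `1 + ζ²⁴ + ζ⁴⁸ = 0`, `ζ⁷² = 1`. [folklore] -/
theorem relations_seventyTwo (hζ : IsPrimitiveRoot ζ 72) :
    1 + ζ ^ 36 = 0 ∧ 1 + ζ ^ 24 + ζ ^ 48 = 0 ∧ ζ ^ 72 = 1 := by
  have h72 : ζ ^ 72 = 1 := hζ.pow_eq_one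
  have h2 := (hζ.pow (by norm_num) (show 72 = 36 * 2 by norm_num)).eq_neg_one_of_two_right
  have hν : IsPrimitiveRoot (ζ ^ 24) 3 := hζ.pow (by norm_num) (by norm_num)
  have hB := hν.geom_sum_eq_zero (by norm_num : 1 < 3)
  simp only [Finset.sum_range_succ, Finset.sum_range_zero, zero_add, ← pow_mul] at hB
  exact ⟨by linear_combination h2, by linear_combination hB, h72⟩

/-- `ζ^ρ = ζ⁷¹` (complex conjugation inverts the root of unity). [folklore] -/
theorem complexConj_zeta (hζ : IsPrimitiveRoot ζ 72) : IsCMField.complexConj K ζ = ζ ^ 71 := by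
  have h72 : ζ ^ 72 = 1 := hζ.pow_eq_one
  rw [complexConj_eq_inv_of_pow_eq_one (by norm_num) h72]
  exact inv_eq_of_mul_eq_one_right (by linear_combination h72)

/-- **`𝔓^ρ = (1 − ζ⁶⁴, 1 + ζ⁶³ + ζ⁴⁵)`**: the image of `𝔓` under `ρ` restricted to `𝓞 K` (`ζ^ρ = ζ⁷¹`). [folklore] -/
theorem map_conj_span_eq (hζ : IsPrimitiveRoot ζ 72) :
    (𝔓[hζ]).map (AmbiguousClass.intAut (IsCMField.complexConj K) : 𝓞 K →+* 𝓞 K) = 𝔓ρ[hζ] := by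
  obtain ⟨-, -, hM⟩ := relations_seventyTwo hζ
  have hc := complexConj_zeta hζ
  have hzK : algebraMap (𝓞 K) K hζ.toInteger = ζ := rfl
  have h8 : (ζ ^ 71) ^ 8 = ζ ^ 64 := by
    rw [← pow_mul, show 71 * 8 = 72 * 7 + 64 by norm_num, pow_add, pow_mul, hM, one_pow, one_mul]
  have h9 : (ζ ^ 71) ^ 9 = ζ ^ 63 := by
    rw [← pow_mul, show 71 * 9 = 72 * 8 + 63 by norm_num, pow_add, pow_mul, hM, one_pow, one_mul]
  have h27 : (ζ ^ 71) ^ 27 = ζ ^ 45 := by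
    rw [← pow_mul, show 71 * 27 = 72 * 26 + 45 by norm_num, pow_add, pow_mul, hM, one_pow, one_mul]
  have h1 : (AmbiguousClass.intAut (IsCMField.complexConj K) : 𝓞 K →+* 𝓞 K) (1 - hζ.toInteger ^ 8) =
      1 - hζ.toInteger ^ 64 := by
    apply RingOfIntegers.ext
    change IsCMField.complexConj K ((1 - hζ.toInteger ^ 8 : 𝓞 K) : K) = ((1 - hζ.toInteger ^ 64 : 𝓞 K) : K)
    push_cast
    simp only [map_sub, map_one, map_pow, hzK, hc, h8]
  have h2 : (AmbiguousClass.intAut (IsCMField.complexConj K) : 𝓞 K →+* 𝓞 K)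
      (1 + hζ.toInteger ^ 9 + hζ.toInteger ^ 27) = 1 + hζ.toInteger ^ 63 + hζ.toInteger ^ 45 := by
    apply RingOfIntegers.ext
    change IsCMField.complexConj K ((1 + hζ.toInteger ^ 9 + hζ.toInteger ^ 27 : 𝓞 K) : K) =
      ((1 + hζ.toInteger ^ 63 + hζ.toInteger ^ 45 : 𝓞 K) : K)
    push_cast
    simp only [map_add, map_one, map_pow, hzK, hc, h9, h27]
  rw [Ideal.map_span, Set.image_pair, h1, h2]

/-- **`(𝔓^ρ)^ρ = 𝔓`** (`ρ² = 1` on the generators: `(ζ⁷¹)⁶⁴ = ζ⁸`, `(ζ⁷¹)⁶³ = ζ⁹`, `(ζ⁷¹)⁴⁵ = ζ²⁷`). [folklore] -/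
theorem map_conj_span_conj_eq (hζ : IsPrimitiveRoot ζ 72) :
    (𝔓ρ[hζ]).map (AmbiguousClass.intAut (IsCMField.complexConj K) : 𝓞 K →+* 𝓞 K) = 𝔓[hζ] := by
  obtain ⟨-, -, hM⟩ := relations_seventyTwo hζ
  have hc := complexConj_zeta hζ
  have hzK : algebraMap (𝓞 K) K hζ.toInteger = ζ := rfl
  have h64 : (ζ ^ 71) ^ 64 = ζ ^ 8 := by
    rw [← pow_mul, show 71 * 64 = 72 * 63 + 8 by norm_num, pow_add, pow_mul, hM, one_pow, one_mul]
  have h63 : (ζ ^ 71) ^ 63 = ζ ^ 9 := by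
    rw [← pow_mul, show 71 * 63 = 72 * 62 + 9 by norm_num, pow_add, pow_mul, hM, one_pow, one_mul]
  have h45 : (ζ ^ 71) ^ 45 = ζ ^ 27 := by
    rw [← pow_mul, show 71 * 45 = 72 * 44 + 27 by norm_num, pow_add, pow_mul, hM, one_pow, one_mul]
  have h1 : (AmbiguousClass.intAut (IsCMField.complexConj K) : 𝓞 K →+* 𝓞 K) (1 - hζ.toInteger ^ 64) =
      1 - hζ.toInteger ^ 8 := by
    apply RingOfIntegers.ext
    change IsCMField.complexConj K ((1 - hζ.toInteger ^ 64 : 𝓞 K) : K) = ((1 - hζ.toInteger ^ 8 : 𝓞 K) : K)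
    push_cast
    simp only [map_sub, map_one, map_pow, hzK, hc, h64]
  have h2 : (AmbiguousClass.intAut (IsCMField.complexConj K) : 𝓞 K →+* 𝓞 K)
      (1 + hζ.toInteger ^ 63 + hζ.toInteger ^ 45) = 1 + hζ.toInteger ^ 9 + hζ.toInteger ^ 27 := by
    apply RingOfIntegers.ext
    change IsCMField.complexConj K ((1 + hζ.toInteger ^ 63 + hζ.toInteger ^ 45 : 𝓞 K) : K) =
      ((1 + hζ.toInteger ^ 9 + hζ.toInteger ^ 27 : 𝓞 K) : K)
    push_cast
    simp only [map_add, map_one, map_pow, hzK, hc, h63, h45]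
  rw [Ideal.map_span, Set.image_pair, h1, h2]

omit [NumberField K] [IsCMField K] in
/-- **`𝔓𝔓^ρ = (1 − ζ⁸)` in `𝓞 K`**: the four products `(1 − ζ⁸)(1 − ζ⁶⁴)`, `(1 − ζ⁸)(1 + ζ⁶³ + ζ⁴⁵)`, `(1 + ζ⁹ + ζ²⁷)(1 − ζ⁶⁴)`,
`(1 + ζ⁹ + ζ²⁷)(1 + ζ⁶³ + ζ⁴⁵) = 3` are `(1 − ζ⁸)`-multiples (explicit quotients), and `1 − ζ⁸ = (1 − ζ⁸)·g₄ − g₂ + ζ⁸·g₃`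
(certificates `g60/py52/cert5272.py`).
research route conditional on HC_CM; not a corollary; Q11.4-sentence-2 already refuted in dim ≥ 3. [folklore] -/
theorem span_mul_span_conj_eq (hζ : IsPrimitiveRoot ζ 72) :
    𝔓[hζ] * 𝔓ρ[hζ] = Ideal.span {1 - hζ.toInteger ^ 8} := by
  obtain ⟨hA, hB, hM⟩ := relations_seventyTwo hζ
  have hzK : algebraMap (𝓞 K) K hζ.toInteger = ζ := rfl
  rw [Ideal.span_pair_mul_span_pair]
  apply le_antisymm
  · rw [Ideal.span_le]
    intro x hx
    simp only [Set.mem_insert_iff, Set.mem_singleton_iff] at hx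
    rw [SetLike.mem_coe, Ideal.mem_span_singleton]
    rcases hx with rfl | rfl | rfl | rfl
    · refine ⟨1 - hζ.toInteger ^ 4 + hζ.toInteger ^ 16, RingOfIntegers.ext ?_⟩
      push_cast; simp only [hzK]
      linear_combination ((-1 : K) * ζ ^ 12 + (-1 : K) * ζ ^ 16 + (1 : K) * ζ ^ 40 + (1 : K) * ζ ^ 52) * hA + ((1 : K) + (1 : K) * ζ ^ 4 + (-1 : K) * ζ ^ 28 + (-1 : K) * ζ ^ 40) * hB + ((1 : K)) * hM
    · refine ⟨1 + hζ.toInteger ^ 3 - hζ.toInteger ^ 9 - hζ.toInteger ^ 15, RingOfIntegers.ext ?_⟩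
      push_cast; simp only [hzK]
      linear_combination ((1 : K) * ζ ^ 15 + (-1 : K) * ζ ^ 21 + (-1 : K) * ζ ^ 23 + (1 : K) * ζ ^ 29 + (-1 : K) * ζ ^ 33 + (-1 : K) * ζ ^ 39 + (1 : K) * ζ ^ 41 + (1 : K) * ζ ^ 47 + (-1 : K) * ζ ^ 51 + (1 : K) * ζ ^ 59) * hA + ((-1 : K) * ζ ^ 3 + (1 : K) * ζ ^ 9 + (1 : K) * ζ ^ 11 + (-1 : K) * ζ ^ 17 + (1 : K) * ζ ^ 21 + (1 : K) * ζ ^ 27 + (-1 : K) * ζ ^ 29 + (-1 : K) * ζ ^ 35 + (1 : K) * ζ ^ 39 + (-1 : K) * ζ ^ 47) * hB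
    · refine ⟨-hζ.toInteger - hζ.toInteger ^ 4 + hζ.toInteger ^ 16 - hζ.toInteger ^ 19, RingOfIntegers.ext ?_⟩
      push_cast; simp only [hzK]
      linear_combination ((-1 : K) * ζ ^ 12 + (-1 : K) * ζ ^ 16 + (1 : K) * ζ ^ 40 + (1 : K) * ζ ^ 52) * hA + ((1 : K) + (1 : K) * ζ ^ 4 + (-1 : K) * ζ ^ 28 + (-1 : K) * ζ ^ 40) * hB + ((-1 : K) * ζ + (-1 : K) * ζ ^ 19) * hM
    · refine ⟨1 - hζ.toInteger ^ 4 + hζ.toInteger ^ 8 + hζ.toInteger ^ 12 + 2 * hζ.toInteger ^ 16 + hζ.toInteger ^ 20,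
        RingOfIntegers.ext ?_⟩
      push_cast; simp only [map_ofNat, hzK]
      linear_combination ((-2 : K) * ζ ^ 12 + (-1 : K) * ζ ^ 16 + (-1 : K) * ζ ^ 21 + (-1 : K) * ζ ^ 30 + (-1 : K) * ζ ^ 33 + (-1 : K) * ζ ^ 39 + (-1 : K) * ζ ^ 42 + (-1 : K) * ζ ^ 51) * hA + ((2 : K) + (1 : K) * ζ ^ 4 + (1 : K) * ζ ^ 9 + (1 : K) * ζ ^ 18 + (1 : K) * ζ ^ 21 + (1 : K) * ζ ^ 27 + (1 : K) * ζ ^ 30 + (1 : K) * ζ ^ 39) * hB + ((2 : K) + (1 : K) * ζ ^ 18) * hM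
  · rw [Ideal.span_singleton_le_iff_mem]
    have heq : (1 - hζ.toInteger ^ 8 : 𝓞 K) =
        (1 - hζ.toInteger ^ 8) * ((1 + hζ.toInteger ^ 9 + hζ.toInteger ^ 27) * (1 + hζ.toInteger ^ 63 + hζ.toInteger ^ 45)) +
          (-1) * ((1 - hζ.toInteger ^ 8) * (1 + hζ.toInteger ^ 63 + hζ.toInteger ^ 45)) +
          hζ.toInteger ^ 8 * ((1 + hζ.toInteger ^ 9 + hζ.toInteger ^ 27) * (1 - hζ.toInteger ^ 64)) := by
      apply RingOfIntegers.ext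
      push_cast; simp only [hzK]
      linear_combination ((1 : K) * ζ ^ 30 + (-1 : K) * ζ ^ 38 + (1 : K) * ζ ^ 42 + (-1 : K) * ζ ^ 50) * hA + ((-1 : K) * ζ ^ 18 + (1 : K) * ζ ^ 26 + (-1 : K) * ζ ^ 30 + (1 : K) * ζ ^ 38) * hB + ((-1 : K) + (2 : K) * ζ ^ 8 + (1 : K) * ζ ^ 9 + (-1 : K) * ζ ^ 18 + (1 : K) * ζ ^ 26 + (1 : K) * ζ ^ 27) * hM
    have hin : ∀ a : 𝓞 K, a ∈ ({(1 - hζ.toInteger ^ 8) * (1 - hζ.toInteger ^ 64),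
          (1 - hζ.toInteger ^ 8) * (1 + hζ.toInteger ^ 63 + hζ.toInteger ^ 45),
          (1 + hζ.toInteger ^ 9 + hζ.toInteger ^ 27) * (1 - hζ.toInteger ^ 64),
          (1 + hζ.toInteger ^ 9 + hζ.toInteger ^ 27) * (1 + hζ.toInteger ^ 63 + hζ.toInteger ^ 45)} : Set (𝓞 K)) →
        a ∈ Ideal.span ({(1 - hζ.toInteger ^ 8) * (1 - hζ.toInteger ^ 64),
          (1 - hζ.toInteger ^ 8) * (1 + hζ.toInteger ^ 63 + hζ.toInteger ^ 45),
          (1 + hζ.toInteger ^ 9 + hζ.toInteger ^ 27) * (1 - hζ.toInteger ^ 64),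
          (1 + hζ.toInteger ^ 9 + hζ.toInteger ^ 27) * (1 + hζ.toInteger ^ 63 + hζ.toInteger ^ 45)} : Set (𝓞 K)) := fun a ha => Ideal.subset_span ha
    have hmem := Ideal.add_mem _ (Ideal.add_mem _
      (Ideal.mul_mem_left _ (1 - hζ.toInteger ^ 8)
        (hin ((1 + hζ.toInteger ^ 9 + hζ.toInteger ^ 27) * (1 + hζ.toInteger ^ 63 + hζ.toInteger ^ 45)) (by simp)))
      (Ideal.mul_mem_left _ (-1) (hin ((1 - hζ.toInteger ^ 8) * (1 + hζ.toInteger ^ 63 + hζ.toInteger ^ 45)) (by simp))))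
      (Ideal.mul_mem_left _ (hζ.toInteger ^ 8) (hin ((1 + hζ.toInteger ^ 9 + hζ.toInteger ^ 27) * (1 - hζ.toInteger ^ 64)) (by simp)))
    rw [← heq] at hmem
    exact hmem

omit [NumberField K] [IsCMField K] in
/-- **`(α) = (1 − ζ⁸)`**: `α = (1 − ζ⁸)·w` with `w = ζ⁵⁸(1 − ζ²⁰)·u(3,15,63)` a unit (part 13: the orders `18, 24, 24` of
`ζ²⁰, ζ³, ζ¹⁵` are not prime powers). [cite: Washington1997, Prop. 2.8] -/
theorem span_alpha_eq (hζ : IsPrimitiveRoot ζ 72) :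
    Ideal.span {(hζ.toInteger ^ 58 * (1 - hζ.toInteger ^ 20) * (1 - hζ.toInteger ^ 8) *
        (hζ.toInteger ^ 63 * (1 - hζ.toInteger ^ 3) * (1 - hζ.toInteger ^ 15)) : 𝓞 K)} =
      Ideal.span {1 - hζ.toInteger ^ 8} := by
  have hz : IsUnit (hζ.toInteger : 𝓞 K) := hζ.toInteger_isPrimitiveRoot.isUnit (by norm_num)
  have hu : ∀ a : ℕ, ¬ 72 ∣ a → ¬ IsPrimePow (72 / Nat.gcd 72 a) → IsUnit (1 - hζ.toInteger ^ a : 𝓞 K) :=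
    fun a ha hnp => isUnit_one_sub_toInteger_pow hζ ha hnp
  have hw : IsUnit (hζ.toInteger ^ 58 * (1 - hζ.toInteger ^ 20) *
      (hζ.toInteger ^ 63 * (1 - hζ.toInteger ^ 3) * (1 - hζ.toInteger ^ 15)) : 𝓞 K) :=
    ((hz.pow 58).mul (hu 20 (by decide) (by decide))).mul
      (((hz.pow 63).mul (hu 3 (by decide) (by decide))).mul (hu 15 (by decide) (by decide)))
  rw [show (hζ.toInteger ^ 58 * (1 - hζ.toInteger ^ 20) * (1 - hζ.toInteger ^ 8) *
        (hζ.toInteger ^ 63 * (1 - hζ.toInteger ^ 3) * (1 - hζ.toInteger ^ 15)) : 𝓞 K) =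
      (1 - hζ.toInteger ^ 8) * (hζ.toInteger ^ 58 * (1 - hζ.toInteger ^ 20) *
        (hζ.toInteger ^ 63 * (1 - hζ.toInteger ^ 3) * (1 - hζ.toInteger ^ 15))) by ring]
  exact Ideal.span_singleton_mul_right_unit hw _

/-- **`𝔓𝔓^ρ = (α)` and `𝔓^ρ(𝔓^ρ)^ρ = (α)` as fractional ideals**, for any invertible `𝔪` equal to `𝔓` or to `𝔓^ρ`. [folklore] -/
theorem mul_conjIdeal_eq_of_coe_eq (hζ : IsPrimitiveRoot ζ 72) (𝔪 : (FractionalIdeal (𝓞 K)⁰ K)ˣ)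
    (h : (𝔪 : FractionalIdeal (𝓞 K)⁰ K) = ((𝔓[hζ] : Ideal (𝓞 K)) : FractionalIdeal (𝓞 K)⁰ K) ∨
      (𝔪 : FractionalIdeal (𝓞 K)⁰ K) = ((𝔓ρ[hζ] : Ideal (𝓞 K)) : FractionalIdeal (𝓞 K)⁰ K)) :
    (𝔪 : FractionalIdeal (𝓞 K)⁰ K) * (CMTypeLattice.conjIdeal 𝔪 : FractionalIdeal (𝓞 K)⁰ K) = spanSingleton (𝓞 K)⁰ α := by
  rcases h with h | h <;>
    rw [CMTypeLattice.coe_conjIdeal, h, AmbiguousClass.fracIdealAut, AmbiguousClass.ringEquivOfRingEquiv_coeIdeal, ← coeIdeal_mul]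
  · rw [map_conj_span_eq hζ, span_mul_span_conj_eq hζ, ← span_alpha_eq hζ, coeIdeal_span_singleton]; rfl
  · rw [map_conj_span_conj_eq hζ, mul_comm, span_mul_span_conj_eq hζ, ← span_alpha_eq hζ, coeIdeal_span_singleton]; rfl

omit [IsCMField K] in
/-- **`𝔓` and `𝔓^ρ` are invertible lattices** (`𝔓𝔓^ρ ∋ 1 − ζ⁸ ≠ 0`). [folklore] -/
theorem exists_units_coe_eq (hζ : IsPrimitiveRoot ζ 72) :
    (∃ 𝔪 : (FractionalIdeal (𝓞 K)⁰ K)ˣ, (𝔪 : FractionalIdeal (𝓞 K)⁰ K) = ((𝔓[hζ] : Ideal (𝓞 K)) : FractionalIdeal (𝓞 K)⁰ K)) ∧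
    (∃ 𝔪 : (FractionalIdeal (𝓞 K)⁰ K)ˣ, (𝔪 : FractionalIdeal (𝓞 K)⁰ K) = ((𝔓ρ[hζ] : Ideal (𝓞 K)) : FractionalIdeal (𝓞 K)⁰ K)) := by
  have h4 : (1 - hζ.toInteger ^ 8 : 𝓞 K) ≠ 0 := by
    intro h0
    have h' := congrArg (fun x : 𝓞 K => (x : K)) h0
    have hzK : algebraMap (𝓞 K) K hζ.toInteger = ζ := rfl
    push_cast at h'
    simp only [hzK] at h'
    exact (hζ.pow (by norm_num) (show 72 = 8 * 9 by norm_num)).ne_one (by norm_num) (sub_eq_zero.mp h').symm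
  have hprod : 𝔓[hζ] * 𝔓ρ[hζ] ≠ ⊥ := by
    rw [span_mul_span_conj_eq hζ, Ne, Ideal.span_singleton_eq_bot]; exact h4
  have hQ : (𝔓[hζ] : Ideal (𝓞 K)) ≠ ⊥ := fun hb => hprod (by rw [hb, Ideal.bot_mul])
  have hQ' : (𝔓ρ[hζ] : Ideal (𝓞 K)) ≠ ⊥ := fun hb => hprod (by rw [hb, Ideal.mul_bot])
  exact ⟨⟨Units.mk0 _ (coeIdeal_ne_zero.mpr hQ), rfl⟩, ⟨Units.mk0 _ (coeIdeal_ne_zero.mpr hQ'), rfl⟩⟩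

end Lattice

/-! ### §3 The verdict repeats: every lattice with `𝔪𝔪^ρ = (α)` behaves like `ℤ[ζ₇₂]` -/

/-- **THE NON-PRINCIPAL CLASSES AT `72` REPEAT THE PRINCIPAL VERDICT.**  For any `K` with `[IsCMField K]` holding a primitive 72nd
root of unity `ζ`, ANY lattice `𝔪` with `𝔪𝔪^ρ = (α)` and any CM type `Φ`: `ℂ^Φ/D(𝔪)` carries an `ι`-compatible principal
polarisation iff `ℂ^Φ/Φ(𝓞_K)` does (part 42's twist principle with `Φ_α = Φ`, `α ≫ 0`).
research route conditional on HC_CM; not a corollary; Q11.4-sentence-2 already refuted in dim ≥ 3. [cite: Shimura1998, §14.4 Prop. 7, p. 105] -/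
theorem principal_iff_of_mul_conjIdeal_eq (hζ : IsPrimitiveRoot ζ 72) (Φ : CMType K) (𝔪 : (FractionalIdeal (𝓞 K)⁰ K)ˣ)
    (h𝔪 : (𝔪 : FractionalIdeal (𝓞 K)⁰ K) * (CMTypeLattice.conjIdeal 𝔪 : FractionalIdeal (𝓞 K)⁰ K) =
      spanSingleton (𝓞 K)⁰ α) :
    (∃ ζ' : K, IsCMField.complexConj K ζ' = -ζ' ∧ (∀ φ : Φ.1, 0 < (φ.1 ζ').im) ∧ CMTypeLattice.IsOfType 𝔪 ζ' ⊤) ↔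
      ∃ ζ' : K, IsCMField.complexConj K ζ' = -ζ' ∧ (∀ φ : Φ.1, 0 < (φ.1 ζ').im) ∧
        CMTypeLattice.IsOfType (1 : (FractionalIdeal (𝓞 K)⁰ K)ˣ) ζ' ⊤ := by
  obtain ⟨hreal, hpos⟩ := alpha_real_pos hζ
  obtain ⟨φ₀⟩ := (inferInstance : Nonempty (K →+* ℂ))
  have h0 : α ≠ 0 := fun h => by
    have := hpos φ₀
    rw [h, map_zero, Complex.zero_re] at this
    exact lt_irrefl _ this
  obtain ⟨Φ', hΦ'⟩ := exists_twist Φ hreal h0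
  rw [exists_pos_isOfType_iff_twist Φ Φ' hreal h0 hΦ' 𝔪 h𝔪 ⊤]
  have hmem := mem_twist_iff_of_pos Φ Φ' hΦ' hpos
  constructor
  · rintro ⟨ζ', h1, h2, h3⟩
    exact ⟨ζ', h1, fun φ => h2 ⟨φ.1, (hmem φ.1).mpr φ.2⟩, h3⟩
  · rintro ⟨ζ', h1, h2, h3⟩
    exact ⟨ζ', h1, fun φ => h2 ⟨φ.1, (hmem φ.1).mp φ.2⟩, h3⟩

/-- **On `𝔓` and on `𝔓^ρ` the verdict is the verdict of `ℤ[ζ₇₂]`**, for every CM type `Φ`.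
research route conditional on HC_CM; not a corollary; Q11.4-sentence-2 already refuted in dim ≥ 3. [cite: Shimura1998, §14.4 Prop. 7, p. 105] -/
theorem principal_iff_seventyTwo_nonprincipal (hζ : IsPrimitiveRoot ζ 72) (Φ : CMType K) (𝔪 : (FractionalIdeal (𝓞 K)⁰ K)ˣ)
    (h : (𝔪 : FractionalIdeal (𝓞 K)⁰ K) = ((𝔓[hζ] : Ideal (𝓞 K)) : FractionalIdeal (𝓞 K)⁰ K) ∨
      (𝔪 : FractionalIdeal (𝓞 K)⁰ K) = ((𝔓ρ[hζ] : Ideal (𝓞 K)) : FractionalIdeal (𝓞 K)⁰ K)) :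
    (∃ ζ' : K, IsCMField.complexConj K ζ' = -ζ' ∧ (∀ φ : Φ.1, 0 < (φ.1 ζ').im) ∧ CMTypeLattice.IsOfType 𝔪 ζ' ⊤) ↔
      ∃ ζ' : K, IsCMField.complexConj K ζ' = -ζ' ∧ (∀ φ : Φ.1, 0 < (φ.1 ζ').im) ∧
        CMTypeLattice.IsOfType (1 : (FractionalIdeal (𝓞 K)⁰ K)ˣ) ζ' ⊤ :=
  principal_iff_of_mul_conjIdeal_eq hζ Φ 𝔪 (mul_conjIdeal_eq_of_coe_eq hζ 𝔪 h)

open scoped Classical in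
/-- **CENSUS ROW `(ℚ(ζ₇₂), ℚ(i))` ON THE NON-PRINCIPAL CLASSES — YES**: for every CM type `Φ` balanced for
`N_K = {7, 11, 19, 23, 31, 35, 43, 47, 55, 59, 67, 71}`, `ℂ^Φ/Φ(𝔓)` and `ℂ^Φ/Φ(𝔓^ρ)` are principally polarisable (part 24 + §3).
research route conditional on HC_CM; not a corollary; Q11.4-sentence-2 already refuted in dim ≥ 3. [cite: Shimura1998, §14.3 Prop. 5, p. 104; §14.4 Prop. 7, p. 105] -/
theorem exists_principal_nonprincipal_seventyTwo_sqrt_neg_one [IsCyclotomicExtension {72} ℚ K] (hζ : IsPrimitiveRoot ζ 72) (Φ : CMType K)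
    (hbal : 2 * ((Finset.univ.filter fun t : ZMod 72 => ∃ σ ∈ Φ.1, σ ζ = 𝐞 t) ∩ ({7, 11, 19, 23, 31, 35, 43, 47, 55, 59, 67, 71} : Finset (ZMod 72))).card =
      (Finset.univ.filter fun t : ZMod 72 => ∃ σ ∈ Φ.1, σ ζ = 𝐞 t).card)
    (𝔪 : (FractionalIdeal (𝓞 K)⁰ K)ˣ) (h : (𝔪 : FractionalIdeal (𝓞 K)⁰ K) = ((𝔓[hζ] : Ideal (𝓞 K)) : FractionalIdeal (𝓞 K)⁰ K) ∨
      (𝔪 : FractionalIdeal (𝓞 K)⁰ K) = ((𝔓ρ[hζ] : Ideal (𝓞 K)) : FractionalIdeal (𝓞 K)⁰ K)) : ∃ ζ' : K, IsCMField.complexConj K ζ' = -ζ' ∧ (∀ φ : Φ.1, 0 < (φ.1 ζ').im) ∧ CMTypeLattice.IsOfType 𝔪 ζ' ⊤ :=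
  (principal_iff_seventyTwo_nonprincipal hζ Φ 𝔪 h).mpr (exists_principal_seventyTwo_sqrt_neg_one hζ Φ hbal)

open scoped Classical in
/-- **CENSUS ROW `(ℚ(ζ₇₂), ℚ(√−2))` ON THE NON-PRINCIPAL CLASSES — YES**: for every CM type `Φ` balanced for
`N_K = {5, 7, 13, 23, 29, 31, 37, 47, 53, 55, 61, 71}`, `ℂ^Φ/Φ(𝔓)` and `ℂ^Φ/Φ(𝔓^ρ)` are principally polarisable (part 24 + §3).
research route conditional on HC_CM; not a corollary; Q11.4-sentence-2 already refuted in dim ≥ 3. [cite: Shimura1998, §14.3 Prop. 5, p. 104; §14.4 Prop. 7, p. 105] -/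
theorem exists_principal_nonprincipal_seventyTwo_sqrt_neg_two [IsCyclotomicExtension {72} ℚ K] (hζ : IsPrimitiveRoot ζ 72) (Φ : CMType K)
    (hbal : 2 * ((Finset.univ.filter fun t : ZMod 72 => ∃ σ ∈ Φ.1, σ ζ = 𝐞 t) ∩ ({5, 7, 13, 23, 29, 31, 37, 47, 53, 55, 61, 71} : Finset (ZMod 72))).card =
      (Finset.univ.filter fun t : ZMod 72 => ∃ σ ∈ Φ.1, σ ζ = 𝐞 t).card)
    (𝔪 : (FractionalIdeal (𝓞 K)⁰ K)ˣ) (h : (𝔪 : FractionalIdeal (𝓞 K)⁰ K) = ((𝔓[hζ] : Ideal (𝓞 K)) : FractionalIdeal (𝓞 K)⁰ K) ∨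
      (𝔪 : FractionalIdeal (𝓞 K)⁰ K) = ((𝔓ρ[hζ] : Ideal (𝓞 K)) : FractionalIdeal (𝓞 K)⁰ K)) : ∃ ζ' : K, IsCMField.complexConj K ζ' = -ζ' ∧ (∀ φ : Φ.1, 0 < (φ.1 ζ').im) ∧ CMTypeLattice.IsOfType 𝔪 ζ' ⊤ :=
  (principal_iff_seventyTwo_nonprincipal hζ Φ 𝔪 h).mpr (exists_principal_seventyTwo_sqrt_neg_two hζ Φ hbal)

open scoped Classical in
/-- **CENSUS ROW `(ℚ(ζ₇₂), ℚ(√−3))` ON THE NON-PRINCIPAL CLASSES — YES**: for every CM type `Φ` balanced for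
`N_K = {5, 11, 17, 23, 29, 35, 41, 47, 53, 59, 65, 71}`, `ℂ^Φ/Φ(𝔓)` and `ℂ^Φ/Φ(𝔓^ρ)` are principally polarisable (part 24 + §3).
research route conditional on HC_CM; not a corollary; Q11.4-sentence-2 already refuted in dim ≥ 3. [cite: Shimura1998, §14.3 Prop. 5, p. 104; §14.4 Prop. 7, p. 105] -/
theorem exists_principal_nonprincipal_seventyTwo_sqrt_neg_three [IsCyclotomicExtension {72} ℚ K] (hζ : IsPrimitiveRoot ζ 72) (Φ : CMType K)
    (hbal : 2 * ((Finset.univ.filter fun t : ZMod 72 => ∃ σ ∈ Φ.1, σ ζ = 𝐞 t) ∩ ({5, 11, 17, 23, 29, 35, 41, 47, 53, 59, 65, 71} : Finset (ZMod 72))).card =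
      (Finset.univ.filter fun t : ZMod 72 => ∃ σ ∈ Φ.1, σ ζ = 𝐞 t).card)
    (𝔪 : (FractionalIdeal (𝓞 K)⁰ K)ˣ) (h : (𝔪 : FractionalIdeal (𝓞 K)⁰ K) = ((𝔓[hζ] : Ideal (𝓞 K)) : FractionalIdeal (𝓞 K)⁰ K) ∨
      (𝔪 : FractionalIdeal (𝓞 K)⁰ K) = ((𝔓ρ[hζ] : Ideal (𝓞 K)) : FractionalIdeal (𝓞 K)⁰ K)) : ∃ ζ' : K, IsCMField.complexConj K ζ' = -ζ' ∧ (∀ φ : Φ.1, 0 < (φ.1 ζ').im) ∧ CMTypeLattice.IsOfType 𝔪 ζ' ⊤ :=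
  (principal_iff_seventyTwo_nonprincipal hζ Φ 𝔪 h).mpr (exists_principal_seventyTwo_sqrt_neg_three hζ Φ hbal)

open scoped Classical in
/-- **CENSUS ROW `(ℚ(ζ₇₂), ℚ(√−6))` ON THE NON-PRINCIPAL CLASSES — YES**: for every CM type `Φ` balanced for
`N_K = {13, 17, 19, 23, 37, 41, 43, 47, 61, 65, 67, 71}`, `ℂ^Φ/Φ(𝔓)` and `ℂ^Φ/Φ(𝔓^ρ)` are principally polarisable (part 24 + §3).
research route conditional on HC_CM; not a corollary; Q11.4-sentence-2 already refuted in dim ≥ 3. [cite: Shimura1998, §14.3 Prop. 5, p. 104; §14.4 Prop. 7, p. 105] -/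
theorem exists_principal_nonprincipal_seventyTwo_sqrt_neg_six [IsCyclotomicExtension {72} ℚ K] (hζ : IsPrimitiveRoot ζ 72) (Φ : CMType K)
    (hbal : 2 * ((Finset.univ.filter fun t : ZMod 72 => ∃ σ ∈ Φ.1, σ ζ = 𝐞 t) ∩ ({13, 17, 19, 23, 37, 41, 43, 47, 61, 65, 67, 71} : Finset (ZMod 72))).card =
      (Finset.univ.filter fun t : ZMod 72 => ∃ σ ∈ Φ.1, σ ζ = 𝐞 t).card)
    (𝔪 : (FractionalIdeal (𝓞 K)⁰ K)ˣ) (h : (𝔪 : FractionalIdeal (𝓞 K)⁰ K) = ((𝔓[hζ] : Ideal (𝓞 K)) : FractionalIdeal (𝓞 K)⁰ K) ∨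
      (𝔪 : FractionalIdeal (𝓞 K)⁰ K) = ((𝔓ρ[hζ] : Ideal (𝓞 K)) : FractionalIdeal (𝓞 K)⁰ K)) : ∃ ζ' : K, IsCMField.complexConj K ζ' = -ζ' ∧ (∀ φ : Φ.1, 0 < (φ.1 ζ').im) ∧ CMTypeLattice.IsOfType 𝔪 ζ' ⊤ :=
  (principal_iff_seventyTwo_nonprincipal hζ Φ 𝔪 h).mpr (exists_principal_seventyTwo_sqrt_neg_six hζ Φ hbal)

end Summit.HodgeConjecture.Ring2WeilCoverage.NonPrincipalLatticeLevel72

end
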